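/-
Copyright (c) 2026. All rights reserved.
Released under Apache 2.0 license as described in the file LICENSE.
-/
import Summits.HodgeConjecture.HodgeConjecture.Theorems.K2LiuArchOnePlaceTubeSectionOfFrame   -- ★ FILE 17 (D-B at the record), FILE 16, FILE 14
import Summits.HodgeConjecture.HodgeConjecture.Theorems.K2LiuArchSectionFlatTwist             -- ★ FILE 13 (D-D) `prod_flatTwist`, `isArchSiegelSection_flatTwist`, `flatTwist_compactPicture`
import Summits.HodgeConjecture.HodgeConjecture.Theorems.K2LiuArchCompactPicturePlaceTensor    -- ★ 2c-inst `exists_sum_prod_archPlaces`, `rightTranslate_isArchSiegelDeltaSection`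
import Summits.HodgeConjecture.HodgeConjecture.Theorems.K2LiuArchSWRegionSpanningTransport    -- ★ `exists_iwasawaDatum_conj`
import HarnessLib

/-!
# Crux `HLiu418`, G6-arch ASSEMBLY FILE 18 — (E8rec) THE PRESENTATION HEAD: (E6′)'s flat arch factor `H_𝒦^{2(s−s₀)}·A` IS a finite sum of PLACE-PURE products of
# FLAT tube Siegel sections with fixed compact pictures, read at the translated point `a·g` (★ 2c-inst + ★ FILES 13–17)

Cell `hodgecm-mathlib`, crux item hLiu418 = `stmt-HodgeConjecture-24832` (helper lane `--supports`, count-neutral).  K2Liu-p11 (g4); consumer: K2Liu-p13 (g4)'s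
`hArch` via the assembly file (presentation ⇒ ★ p862521 §5 per summand).  Head bytes announced 22:37:31Z.

INPUT (★ (E6′) `exists_awayPurity_flat`'s arch letters): `A : H_∞ → ℂ` with the arch Siegel law at `s₀` (★ `IsArchSiegelDeltaSection χ s₀ A`; (E6′)'s `p_f = 1` form converts by
★ `isArchSiegelDeltaSection_of_finPart_eq_one`), `K_∞`-finiteness w.r.t. the datum `𝒦` (★ `IsArchKFinite 𝒦 A`, (E6′)'s bytes verbatim), continuity; a Hecke character of unitary
archimedean type `(t, 0)`; the tube frame of record BY VALUE (★ `K2LiuHolTubeRigidityOfFrame` §2 letters + ★ arch₃∕arch₄ clauses + Shimura shape + reading frames ★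
`exists_readingFrame`); and the CONJUGATOR LETTER `hg : (∀ w, Fr k w ∈ Stab(i1)) → (g k g⁻¹, 1) ∈ 𝒦.K` (the standard datum's arch compact is `g·K_fr·g⁻¹`: ★ B2
`K2LiuStdArchCompactConjugate.exists_conj_archCompact` + the frame reading of the sign-block compact — the one letter left to the S2 (B) lineage).
* §1 **`exists_tube_presentation`** — AT `s₀`: `∃ m c Q F`, `F r w ∈ I_w(s₀, χ_{−t_w})`, `cp (F r w) = Q r w`, `∀ a, A a = Σ_r c_r ∏_w F r w (Fr (a·g) w)`
  (★ `exists_iwasawaDatum_conj` for the conjugate datum `𝒦₀ = ĝ⁻¹𝒦ĝ`; `A′ := A(·g⁻¹)` is `𝒦₀`-finite (★ `rightTranslate_isArchSiegelDeltaSection`); ★ 2c-inst at `Kw := K_fr`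
  ((k1) from `hg` + ★ `archAt_slice`; (k2) from ★ FILE 16 `exists_siegel_mul_stab_archLocal` + ★ `isSiegelDelta_slice_of_toBlocks₂₁`); ★ FILE 17 per `(r, w)`).
* §2 `cpow_height_eq` — the height algebra `H_a·J = H_g ⇒ H_a^{2(s−s₀)} = H_g^{2(s−s₀)}·J^{2(s₀−s)}` for positive reals.
* §3 **`exists_flat_tube_presentation`** — THE HEAD: `∃ m c Q F` as in §1 and, for EVERY `s a`,
  `H_𝒦(a)^{2(s−s₀)}·A a = H_𝒦(g⁻¹)^{2(s−s₀)} · Σ_r c_r ∏_w (‖j(·,i1)‖^{2(s₀−s)}·F r w)(Fr (a·g) w)` (★ FILE 16 `heightArch_mul_prod_eq_heightArch_inv` + §2 + ★ FILE 13 `prod_flatTwist`),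
  the twisted sections being flat: `∈ I_w(s, χ_{−t_w})` with `cp = Q r w` at every `s` (★ FILE 13).
References: [Shimura1997, §§5–6, §16.4]; [KudlaRallis1994, §1]; [Tan1999, §1]; [BorelJacquet1979, §4.1]; [LeeZhu1998, §5].
HONEST LABEL: HC_CM is proved only modulo the 7 printed citations (2 remaining named inputs: hLiu418 = stmt-HodgeConjecture-24832,
h413 = stmt-HodgeConjecture-24833) until rung 0 closes; count-neutral helper, closes no socket.
-/

set_option autoImplicit false
set_option linter.dupNamespace false

noncomputable section

open scoped Matrix ComplexConjugate Classical
open Complex Matrix NumberField NumberField.InfinitePlace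
open Literature.NumberTheory.ModularForms.SiegelUpperHalfSpace (denom moeb moeb_one)
open Literature.NumberTheory.Automorphic (ofReal_prod_cpow)
open Literature.NumberTheory.Automorphic Literature.NumberTheory.Automorphic.UnitaryGroup Literature.NumberTheory.GaloisRepresentations
open Literature.NumberTheory.GelbartRogawski1991 Literature.NumberTheory.GelbartRogawski1991.GRConstruction
open Literature.NumberTheory.GelbartRogawski1991.UnitaryDualPair
open Literature.NumberTheory.K2Lit.SiegelDoubled

namespace Summit.HodgeConjecture.HodgeConjecture.Cruxes.HLiu418.K2LiuArchFlatTubePresentation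

open K2LiuU22CompactPictureDefs K2LiuArchInducedTubeDefs K2LiuHermitianTubeCocycle K2LiuHolTubeRigidityOfFrame K2LiuArchSiegelCharacterTube
  K2LiuArchSWSpanningDefs K2LiuArchStabIwasawaOfFrame K2LiuArchSectionFlatTwist
open K2LiuArchCompactPicturePlaceTensor (exists_sum_prod_archPlaces rightTranslate_isArchSiegelDeltaSection)
open K2LiuArchSWRegionSpanningTransport (exists_iwasawaDatum_conj)
open K2LiuArchOnePlaceTubeSectionOfFrame (exists_tubeSection_of_frame)

variable (L : Type) [Field L] [NumberField L] [IsCMField L] {N M : ℕ} (e : Fin N × Fin M ≃ Fin 2)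
  (dV : Fin N → L) (hdV : ∀ i, IsCMField.complexConj L (dV i) = dV i) (hdV0 : ∀ i, dV i ≠ 0)
  (dW : Fin M → L) (hdW : ∀ i, IsCMField.complexConj L (dW i) = dW i) (hdW0 : ∀ i, dW i ≠ 0)
  (T Tinv : {w : InfinitePlace L // w.IsComplex} → Matrix (Fin 2 ⊕ Fin 2) (Fin 2 ⊕ Fin 2) ℂ)
  (Fr : UnitaryGroup.arch (Fp L) L (IsCMField.complexConj L) (2 + 2) (hermD L e dV hdV dW hdW) →
    {w : InfinitePlace L // w.IsComplex} → Matrix (Fin 2 ⊕ Fin 2) (Fin 2 ⊕ Fin 2) ℂ)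
  (hFr : ∀ a w, Fr a w = T w * Matrix.reindex (e₂ (n := 2)).symm (e₂ (n := 2)).symm
    (((UnitaryGroup.archAt (Fp L) L (IsCMField.complexConj L) (2 + 2) (hermD L e dV hdV dW hdW) w
      (UnitaryGroup.complexConj_smul_infinitePlace L w.1) (IsCMField.complexConj_ne_one L) a :
        UnitaryGroup.archLocal L (2 + 2) (hermD L e dV hdV dW hdW) w) : GL (Fin (2 + 2)) ℂ) : Matrix (Fin (2 + 2)) (Fin (2 + 2)) ℂ) * Tinv w)
  (hT1 : ∀ w, T w * Tinv w = 1) (hT2 : ∀ w, Tinv w * T w = 1)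
  (hTU : ∀ w (g : GL (Fin (2 + 2)) ℂ), g ∈ UnitaryGroup.archLocal L (2 + 2) (hermD L e dV hdV dW hdW) w →
    (T w * Matrix.reindex (e₂ (n := 2)).symm (e₂ (n := 2)).symm (g : Matrix _ _ ℂ) * Tinv w)ᴴ * Matrix.J (Fin 2) ℂ *
      (T w * Matrix.reindex (e₂ (n := 2)).symm (e₂ (n := 2)).symm (g : Matrix _ _ ℂ) * Tinv w) = Matrix.J (Fin 2) ℂ)
  (hTS : ∀ w (g : GL (Fin (2 + 2)) ℂ), IsSiegelM (n := 2) (g : Matrix (Fin (2 + 2)) (Fin (2 + 2)) ℂ) →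
    (T w * Matrix.reindex (e₂ (n := 2)).symm (e₂ (n := 2)).symm (g : Matrix _ _ ℂ) * Tinv w).toBlocks₂₁ = 0)
  (hTV : ∀ w (P : Matrix (Fin 2 ⊕ Fin 2) (Fin 2 ⊕ Fin 2) ℂ), Pᴴ * Matrix.J (Fin 2) ℂ * P = Matrix.J (Fin 2) ℂ →
    ∃ g : GL (Fin (2 + 2)) ℂ, g ∈ UnitaryGroup.archLocal L (2 + 2) (hermD L e dV hdV dW hdW) w ∧
      T w * Matrix.reindex (e₂ (n := 2)).symm (e₂ (n := 2)).symm (g : Matrix _ _ ℂ) * Tinv w = P)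
  (D C : {w : InfinitePlace L // w.IsComplex} → Matrix (Fin 2) (Fin 2) ℂ)
  (hTsh : ∀ w, T w = fromBlocks (D w) (D w) (C w) (-(C w))) (hD : ∀ w, IsUnit (D w).det) (hC : ∀ w, IsUnit (C w).det)
  (fr : ∀ w : {w : InfinitePlace L // w.IsComplex}, Matrix.unitaryGroup (Fin 2) ℂ →* UnitaryGroup.archLocal L (2 + 2) (hermD L e dV hdV dW hdW) w)
  (hfrc : ∀ w, Continuous (fr w))
  (hfrτ : ∀ w (u : Matrix.unitaryGroup (Fin 2) ℂ),
    T w * Matrix.reindex (e₂ (n := 2)).symm (e₂ (n := 2)).symm (((fr w u : UnitaryGroup.archLocal L (2 + 2) (hermD L e dV hdV dW hdW) w) : GL (Fin (2 + 2)) ℂ) :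
      Matrix (Fin (2 + 2)) (Fin (2 + 2)) ℂ) * Tinv w =
    (2 : ℂ)⁻¹ • fromBlocks (1 + (u : Matrix (Fin 2) (Fin 2) ℂ)) (-(I • (1 - (u : Matrix (Fin 2) (Fin 2) ℂ)))) (I • (1 - (u : Matrix (Fin 2) (Fin 2) ℂ))) (1 + (u : Matrix (Fin 2) (Fin 2) ℂ)))

/-! ## §1  The presentation at `s₀` -/

include hFr hT1 hT2 hTU hTV hTsh hD hC hfrc hfrτ in
/-- **THE TUBE PRESENTATION AT `s₀`** of a continuous `K_∞`-finite arch Siegel section, at the translated point `a·g` for a conjugator `g` with `g·K_fr·g⁻¹ ⊆` the datum's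
arch compact (see the module docstring for the road). [BorelJacquet1979, §4.1] [LeeZhu1998, §5] [Shimura1997, §16.4] -/
theorem exists_tube_presentation (𝒦 : IwasawaDatum L e dV hdV dW hdW)
    (g : UnitaryGroup.arch (Fp L) L (IsCMField.complexConj L) (2 + 2) (hermD L e dV hdV dW hdW))
    (hg : ∀ k : UnitaryGroup.arch (Fp L) L (IsCMField.complexConj L) (2 + 2) (hermD L e dV hdV dW hdW),
      (∀ w, moeb (Fr k w) (I • (1 : Matrix (Fin 2) (Fin 2) ℂ)) = I • 1) →
        (UnitaryGroup.archToAdelic (Fp L) L (IsCMField.complexConj L) (2 + 2) (hermD L e dV hdV dW hdW) (g * k * g⁻¹) : HA L e dV hdV dW hdW) ∈ 𝒦.K)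
    {χ : HeckeCharacter L} {t : InfinitePlace L → ℤ} (ht : χ.HasUnitaryArchType t 0) (s₀ : ℂ)
    {A : UnitaryGroup.arch (Fp L) L (IsCMField.complexConj L) (2 + 2) (hermD L e dV hdV dW hdW) → ℂ}
    (hA : IsArchSiegelDeltaSection L e dV hdV dW hdW χ s₀ A) (hK : IsArchKFinite L e dV hdV dW hdW 𝒦 A) (hAc : Continuous A) :
    ∃ (m : ℕ) (c : Fin m → ℂ) (Q : Fin m → {w : InfinitePlace L // w.IsComplex} → Carrier)
      (F : Fin m → {w : InfinitePlace L // w.IsComplex} → Matrix (Fin 2 ⊕ Fin 2) (Fin 2 ⊕ Fin 2) ℂ → ℂ),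
      (∀ r w, IsArchSiegelSection (fun z : ℂ => (conj z / ((‖z‖ : ℝ) : ℂ)) ^ (-(t w.1))) s₀ (F r w)) ∧
      (∀ r w (v : Matrix (Fin 2) (Fin 2) ℂ), vᴴ * v = 1 → ∀ hv : v.det ≠ 0,
        F r w ((2 : ℂ)⁻¹ • fromBlocks (1 + v) (-(I • (1 - v))) (I • (1 - v)) (1 + v) : Matrix (Fin 2 ⊕ Fin 2) (Fin 2 ⊕ Fin 2) ℂ) = evalAt v hv (Q r w)) ∧
      ∀ a, A a = ∑ r, c r * ∏ w, F r w (Fr (a * g) w) := by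
  -- the conjugate datum `𝒦₀`: `(k,1) ∈ 𝒦₀.K ↔ (g k g⁻¹, 1) ∈ 𝒦.K`
  obtain ⟨𝒦₀, h𝒦₀⟩ := exists_iwasawaDatum_conj L 𝒦
    (UnitaryGroup.archToAdelic (Fp L) L (IsCMField.complexConj L) (2 + 2) (hermD L e dV hdV dW hdW) g)
  have hmemK₀ : ∀ k : UnitaryGroup.arch (Fp L) L (IsCMField.complexConj L) (2 + 2) (hermD L e dV hdV dW hdW),
      (UnitaryGroup.archToAdelic (Fp L) L (IsCMField.complexConj L) (2 + 2) (hermD L e dV hdV dW hdW) (g * k * g⁻¹) : HA L e dV hdV dW hdW) ∈ 𝒦.K →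
      (UnitaryGroup.archToAdelic (Fp L) L (IsCMField.complexConj L) (2 + 2) (hermD L e dV hdV dW hdW) k : HA L e dV hdV dW hdW) ∈ 𝒦₀.K := by
    intro k hk
    refine (h𝒦₀ _).2 ?_
    have hk' := hk
    rw [map_mul, map_mul, map_inv] at hk'
    exact hk'
  -- the right translate `A′ := A(· g⁻¹)` is a continuous `𝒦₀`-finite arch Siegel section
  have hA' : IsArchSiegelDeltaSection L e dV hdV dW hdW χ s₀ (fun x => A (x * g⁻¹)) := rightTranslate_isArchSiegelDeltaSection L e dV hdV dW hdW hA g⁻¹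
  have hAc' : Continuous (fun x => A (x * g⁻¹)) := hAc.comp (continuous_id.mul continuous_const)
  have hK' : IsArchKFinite L e dV hdV dW hdW 𝒦₀ (fun x => A (x * g⁻¹)) := by
    obtain ⟨V, hVfd, hAV, hVst⟩ := hK
    haveI := hVfd
    refine ⟨V.map (LinearMap.funLeft ℂ ℂ (fun x => x * g⁻¹)), Module.Finite.map V _, ⟨A, hAV, rfl⟩, ?_⟩
    rintro a₀ ha₀ _ ⟨G, hG, rfl⟩
    have hmem : (UnitaryGroup.archToAdelic (Fp L) L (IsCMField.complexConj L) (2 + 2) (hermD L e dV hdV dW hdW) (g * a₀ * g⁻¹) : HA L e dV hdV dW hdW) ∈ 𝒦.K := by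
      have h := (h𝒦₀ _).1 ha₀
      rw [map_mul, map_mul, map_inv]
      exact h
    refine ⟨fun x => G (x * (g * a₀ * g⁻¹)), hVst _ hmem G hG, funext fun x => ?_⟩
    simp only [LinearMap.funLeft_apply]
    congr 1
    group
  -- the frame compact `K_fr,w` at each place, with (k1) and (k2)
  have hinv : ∀ w, Tinv w * fromBlocks (D w) (D w) (C w) (-(C w)) = 1 := fun w => by rw [← hTsh]; exact hT2 w
  have hk1 : ∀ (w : {w : InfinitePlace L // w.IsComplex}) (k : UnitaryGroup.archLocal L (2 + 2) (hermD L e dV hdV dW hdW) w),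
      k ∈ {k : UnitaryGroup.archLocal L (2 + 2) (hermD L e dV hdV dW hdW) w |
        moeb (T w * Matrix.reindex (e₂ (n := 2)).symm (e₂ (n := 2)).symm ((k : GL (Fin (2 + 2)) ℂ) : Matrix (Fin (2 + 2)) (Fin (2 + 2)) ℂ) * Tinv w)
          (I • (1 : Matrix (Fin 2) (Fin 2) ℂ)) = I • 1} →
      (UnitaryGroup.archToAdelic (Fp L) L (IsCMField.complexConj L) (2 + 2) (hermD L e dV hdV dW hdW)
        ((UnitaryGroup.archPiEquivCM (2 + 2) L (hermD L e dV hdV dW hdW)).symm (Pi.mulSingle w k)) : HA L e dV hdV dW hdW) ∈ 𝒦₀.K := by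
    intro w k hk
    refine hmemK₀ _ (hg _ fun w' => ?_)
    rw [hFr, archAt_slice L e dV hdV dW hdW w k w']
    by_cases hw' : w' = w
    · subst hw'
      rw [Pi.mulSingle_eq_same]
      exact hk
    · rw [Pi.mulSingle_eq_of_ne hw', OneMemClass.coe_one, Units.val_one, Matrix.reindex_apply, Matrix.submatrix_one_equiv, Matrix.mul_one, hT1, moeb_one]
  have hk2 : ∀ (w : {w : InfinitePlace L // w.IsComplex}) (x : UnitaryGroup.archLocal L (2 + 2) (hermD L e dV hdV dW hdW) w),
      ∃ p : UnitaryGroup.archLocal L (2 + 2) (hermD L e dV hdV dW hdW) w,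
        IsSiegelDelta L e dV hdV dW hdW (UnitaryGroup.archToAdelic (Fp L) L (IsCMField.complexConj L) (2 + 2) (hermD L e dV hdV dW hdW)
          ((UnitaryGroup.archPiEquivCM (2 + 2) L (hermD L e dV hdV dW hdW)).symm (Pi.mulSingle w p))) ∧
        ∃ k ∈ {k : UnitaryGroup.archLocal L (2 + 2) (hermD L e dV hdV dW hdW) w |
          moeb (T w * Matrix.reindex (e₂ (n := 2)).symm (e₂ (n := 2)).symm ((k : GL (Fin (2 + 2)) ℂ) : Matrix (Fin (2 + 2)) (Fin (2 + 2)) ℂ) * Tinv w)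
            (I • (1 : Matrix (Fin 2) (Fin 2) ℂ)) = I • 1}, x = p * k := by
    intro w x
    obtain ⟨p, k, hp, hk, hTp, hTk, hdec⟩ := exists_siegel_mul_stab_archLocal L e dV hdV dW hdW T Tinv hT2 hTU hTV w x.2
    have hP : (fromBlocks (D w) (D w) (C w) (-(C w)) * Matrix.reindex (e₂ (n := 2)).symm (e₂ (n := 2)).symm (p : Matrix (Fin (2 + 2)) (Fin (2 + 2)) ℂ) *
        Tinv w).toBlocks₂₁ = 0 := by rw [← hTsh]; exact hTp
    exact ⟨⟨p, hp⟩, isSiegelDelta_slice_of_toBlocks₂₁ L e dV hdV dW hdW w (D w) (C w) (Tinv w) (hinv w) (hC w) ⟨p, hp⟩ hP, ⟨k, hk⟩, hTk, Subtype.ext hdec⟩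
  -- ★ 2c-inst: place purity
  obtain ⟨m, cr, b, S, hSfd, hbS, hSst, hlawb, hcont, hsum⟩ :=
    exists_sum_prod_archPlaces L e dV hdV dW hdW 𝒦₀ χ s₀ hA' hK' hAc' _ hk1 hk2
  -- ★ FILE 17 per `(r, w)`
  have hsec : ∀ r w, ∃ (F : Matrix (Fin 2 ⊕ Fin 2) (Fin 2 ⊕ Fin 2) ℂ → ℂ) (Q : Carrier),
      IsArchSiegelSection (fun z : ℂ => (conj z / ((‖z‖ : ℝ) : ℂ)) ^ (-(t w.1))) s₀ F ∧
      (∀ (v : Matrix (Fin 2) (Fin 2) ℂ), vᴴ * v = 1 → ∀ hv : v.det ≠ 0,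
        F ((2 : ℂ)⁻¹ • fromBlocks (1 + v) (-(I • (1 - v))) (I • (1 - v)) (1 + v) : Matrix (Fin 2 ⊕ Fin 2) (Fin 2 ⊕ Fin 2) ℂ) = evalAt v hv Q) ∧
      ∀ x : UnitaryGroup.archLocal L (2 + 2) (hermD L e dV hdV dW hdW) w,
        F (T w * Matrix.reindex (e₂ (n := 2)).symm (e₂ (n := 2)).symm ((x : GL (Fin (2 + 2)) ℂ) : Matrix (Fin (2 + 2)) (Fin (2 + 2)) ℂ) * Tinv w) = b r w x := by
    intro r w
    haveI := hSfd w
    exact exists_tubeSection_of_frame L e dV hdV dW hdW w T Tinv hT1 hT2 hTV D C hTsh hD hC (fr w) (hfrc w) (hfrτ w) ht s₀ (b r w) (hcont r w)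
      (hlawb r w) (S w) (hbS r w) (fun f hf k hk => hSst w f hf k hk)
  choose F Q hF hQ hFb using hsec
  refine ⟨m, cr, Q, F, hF, hQ, fun a => ?_⟩
  have hAa : A a = A (a * g * g⁻¹) := by rw [mul_inv_cancel_right]
  rw [hAa, hsum (a * g)]
  refine Finset.sum_congr rfl fun r _ => ?_
  congr 1
  refine Finset.prod_congr rfl fun w _ => ?_
  rw [← hFb r w, hFr]
  rfl

/-! ## §2  The height algebra -/

/-- `H_a · J = H_g` with `H_a, H_g, J > 0` ⇒ `H_a^{2(s−s₀)} = H_g^{2(s−s₀)} · J^{2(s₀−s)}` (complex powers of positive reals). [folklore] -/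
theorem cpow_height_eq {Ha Hg J : ℝ} (hJ : 0 < J) (hHg : 0 < Hg) (h : Ha * J = Hg) (s s₀ : ℂ) :
    ((Ha : ℝ) : ℂ) ^ (2 * (s - s₀)) = ((Hg : ℝ) : ℂ) ^ (2 * (s - s₀)) * ((J : ℝ) : ℂ) ^ (2 * (s₀ - s)) := by
  have hHa : Ha = Hg * J⁻¹ := by rw [← h, mul_inv_cancel_right₀ hJ.ne']
  have hJ0 : ((J : ℝ) : ℂ) ≠ 0 := by exact_mod_cast hJ.ne'
  have harg : ((J : ℝ) : ℂ).arg ≠ Real.pi := by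
    rw [Complex.arg_ofReal_of_nonneg hJ.le]; exact Real.pi_ne_zero.symm
  rw [hHa, Complex.ofReal_mul, Complex.mul_cpow_ofReal_nonneg hHg.le (inv_nonneg.2 hJ.le), Complex.ofReal_inv, Complex.inv_cpow _ _ harg,
    ← Complex.cpow_neg]
  congr 2
  ring

/-! ## §3  THE PRESENTATION HEAD -/

include hFr hT1 hT2 hTU hTS hTV hTsh hD hC hfrc hfrτ hdV0 hdW0 in
/-- **(E8rec) PRESENTATION HEAD.**  For an Iwasawa datum `𝒦`, a conjugator `g` with `hg`, a Hecke character of unitary archimedean type `(t,0)`, and a continuous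
`K_∞`-finite arch Siegel section `A` at `s₀`: there are finitely many flat place-pure products of tube Siegel sections with fixed compact pictures presenting (E6′)'s
flat arch factor at the translated point — for every `s` and `a`,
`H_𝒦(a)^{2(s−s₀)} · A a = H_𝒦(g⁻¹)^{2(s−s₀)} · Σ_r c_r ∏_w (‖j(·, i1)‖^{2(s₀−s)} · F r w)(Fr (a·g) w)`,
with `‖j(·,i1)‖^{2(s₀−s)}·F r w ∈ I_w(s, χ_{−t_w})` and `cp = Q r w` at every `s` (★ FILE 13).  The assembly file turns this into K2Liu-p13's `hArch` bytes by ★ p862521 §5.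
[Shimura1997, §16.4] [KudlaRallis1994, §1] [Tan1999, §1] [BorelJacquet1979, §4.1] -/
theorem exists_flat_tube_presentation (𝒦 : IwasawaDatum L e dV hdV dW hdW)
    (g : UnitaryGroup.arch (Fp L) L (IsCMField.complexConj L) (2 + 2) (hermD L e dV hdV dW hdW))
    (hg : ∀ k : UnitaryGroup.arch (Fp L) L (IsCMField.complexConj L) (2 + 2) (hermD L e dV hdV dW hdW),
      (∀ w, moeb (Fr k w) (I • (1 : Matrix (Fin 2) (Fin 2) ℂ)) = I • 1) →
        (UnitaryGroup.archToAdelic (Fp L) L (IsCMField.complexConj L) (2 + 2) (hermD L e dV hdV dW hdW) (g * k * g⁻¹) : HA L e dV hdV dW hdW) ∈ 𝒦.K)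
    {χ : HeckeCharacter L} {t : InfinitePlace L → ℤ} (ht : χ.HasUnitaryArchType t 0) (s₀ : ℂ)
    {A : UnitaryGroup.arch (Fp L) L (IsCMField.complexConj L) (2 + 2) (hermD L e dV hdV dW hdW) → ℂ}
    (hA : IsArchSiegelDeltaSection L e dV hdV dW hdW χ s₀ A) (hK : IsArchKFinite L e dV hdV dW hdW 𝒦 A) (hAc : Continuous A) :
    ∃ (m : ℕ) (c : Fin m → ℂ) (Q : Fin m → {w : InfinitePlace L // w.IsComplex} → Carrier)
      (F : Fin m → {w : InfinitePlace L // w.IsComplex} → Matrix (Fin 2 ⊕ Fin 2) (Fin 2 ⊕ Fin 2) ℂ → ℂ),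
      (∀ s r w, IsArchSiegelSection (fun z : ℂ => (conj z / ((‖z‖ : ℝ) : ℂ)) ^ (-(t w.1))) s
        (fun x => (((‖(denom x (I • (1 : Matrix (Fin 2) (Fin 2) ℂ))).det‖ : ℝ) : ℂ) ^ (2 * (s₀ - s))) * F r w x)) ∧
      (∀ s r w (v : Matrix (Fin 2) (Fin 2) ℂ), vᴴ * v = 1 → ∀ hv : v.det ≠ 0,
        (fun x => (((‖(denom x (I • (1 : Matrix (Fin 2) (Fin 2) ℂ))).det‖ : ℝ) : ℂ) ^ (2 * (s₀ - s))) * F r w x)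
          ((2 : ℂ)⁻¹ • fromBlocks (1 + v) (-(I • (1 - v))) (I • (1 - v)) (1 + v) : Matrix (Fin 2 ⊕ Fin 2) (Fin 2 ⊕ Fin 2) ℂ) = evalAt v hv (Q r w)) ∧
      ∀ (s : ℂ) (a : UnitaryGroup.arch (Fp L) L (IsCMField.complexConj L) (2 + 2) (hermD L e dV hdV dW hdW)),
        (((modDelta L e dV hdV dW hdW (𝒦.pPart (UnitaryGroup.archToAdelic (Fp L) L (IsCMField.complexConj L) (2 + 2) (hermD L e dV hdV dW hdW) a)) : ℝ) : ℂ) ^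
            (2 * (s - s₀))) * A a =
          (((modDelta L e dV hdV dW hdW (𝒦.pPart (UnitaryGroup.archToAdelic (Fp L) L (IsCMField.complexConj L) (2 + 2) (hermD L e dV hdV dW hdW) g⁻¹)) : ℝ) : ℂ) ^
            (2 * (s - s₀))) *
          ∑ r, c r * ∏ w, (((‖(denom (Fr (a * g) w) (I • (1 : Matrix (Fin 2) (Fin 2) ℂ))).det‖ : ℝ) : ℂ) ^ (2 * (s₀ - s))) * F r w (Fr (a * g) w) := by
  obtain ⟨m, c, Q, F, hF, hQ, hsum⟩ := exists_tube_presentation L e dV hdV dW hdW T Tinv Fr hFr hT1 hT2 hTU hTV D C hTsh hD hC fr hfrc hfrτ 𝒦 g hg ht s₀ hA hK hAc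
  refine ⟨m, c, Q, F, fun s r w => isArchSiegelSection_flatTwist (hF r w) s, fun s r w v hv hdet => flatTwist_compactPicture s₀ s (hQ r w) v hv hdet, fun s a => ?_⟩
  -- the height at `a` through the frame at `a·g`
  have hprod : 0 < ∏ w : {w : InfinitePlace L // w.IsComplex}, ‖(denom (Fr (a * g) w) (I • (1 : Matrix (Fin 2) (Fin 2) ℂ))).det‖ :=
    Finset.prod_pos fun w _ => norm_pos_iff.2 (det_denom_ne_zero (frame_mem L e dV hdV dW hdW T Tinv Fr hFr hTU (a * g) w) posDef_im_I_smul_one)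
  have hheight := heightArch_mul_prod_eq_heightArch_inv L e dV hdV hdV0 dW hdW hdW0 T Tinv Fr hFr hT2 hTU hTS hTV D C hTsh hD hC 𝒦 g hg a
  rw [cpow_height_eq hprod (modDelta_pos L e dV hdV dW hdW _) hheight s s₀, hsum a, Finset.mul_sum, Finset.mul_sum]
  refine Finset.sum_congr rfl fun r _ => ?_
  rw [Finset.prod_mul_distrib, ← ofReal_prod_cpow _ _ (fun w _ => norm_nonneg _)]
  ring

end Summit.HodgeConjecture.HodgeConjecture.Cruxes.HLiu418.K2LiuArchFlatTubePresentation

end
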